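import Mathlib.Analysis.SpecificLimits.Basic
import Summits.KontsevichZagierPeriods.Zeta5Search.Zudilin2002Casoratian
import HarnessLib

/-!
# ζ(5) search — certified geometric convergence of Zudilin's approximants `pₙ/qₙ` (cell `pub-zeta5`, TYPER)

HONEST FRAMING: systematic search; no irrationality claim unless certified.

Third part of the kernel-certified study of Zudilin's 2002 recursion (after
`Zudilin2002Growth.lean` — `796 ≤ |q_{n+1}/qₙ| ≤ 2369` — and `Zudilin2002Casoratian.lean` —
`130 ≤ |W_{n+1}/Wₙ| ≤ 1045`, `Wₙ = qₙp_{n+1} - q_{n+1}pₙ ≠ 0`). Telescoping the two brackets: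

* `abs_ratio_step_le` — `|p_{3+m}/q_{3+m} - p_{2+m}/q_{2+m}| ≤ K · θ^m` with the explicit
  constants `K = (5038915/108)/(17934² · 796)`, `θ = 1045/796² = 1045/633616` (`log θ = -6.407…`);
* `exists_limit` — the approximants converge: there is `L` with `pₙ/qₙ → L` and
  `|p_{2+m}/q_{2+m} - L| ≤ K θ^m / (1 - θ)` for every `m` (Mathlib's geometric Cauchy lemmas);
* `abs_sub_zetaFive_le_of_tendsto` — IF the limit is `ζ(5)` (the analytic input: Zudilin's
  Theorem 1, `ℓₙ = qₙζ(5) - pₙ → 0`, a named fact in the tree which is NOT proved or used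
  unconditionally here), then `|ζ(5) - p_{2+m}/q_{2+m}| ≤ K θ^m/(1 - θ)`: a certified — but
  conditional — approximation rate `e^{-6.4 n}` (the true rate is `μ₂/|μ₃| = e^{-8.86 n}`; the loss
  is the width of the fixed ratio boxes, cf. the module docstrings of the two previous files);
* `tendsto_ratio_of_theorem1_rates`, `abs_sub_zetaFive_le_of_theorem1_rates` — the same with the
  hypothesis discharged from the tree's NAMED FACT `Zudilin2002.theorem1_rates` (conditional results:
  the gate records them as such).

Everything is PROVED (0 sorry); no new definitions.
-/

noncomputable section

open Filter Topology Finset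
open Literature.NumberTheory.Irrationality.Zudilin2002
open Literature.NumberTheory.Transcendental

namespace Summit.KontsevichZagierPeriods.Zeta5Search

namespace Zudilin2002Growth

/-- **One step, explicit geometric bound**: for every `m`,
`|p_{3+m}/q_{3+m} - p_{2+m}/q_{2+m}| ≤ K θ^m`, `K = (5038915/108)/(17934²·796)`, `θ = 1045/796²`. -/
theorem abs_ratio_step_le (m : ℕ) :
    |(p (2 + m + 1) : ℝ) / q (2 + m + 1) - (p (2 + m) : ℝ) / q (2 + m)| ≤
      5038915 / 108 / (17934 ^ 2 * 796) * (1045 / 796 ^ 2) ^ m := by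
  have hn : 2 ≤ 2 + m := by omega
  rw [abs_ratio_step_eq (2 + m) hn]
  -- numerator: `Z (2+m) ≤ Z 2 · 1045^m`
  have hZ : Z (2 + m) ≤ 5038915 / 108 * 1045 ^ m := by
    have h := le_of_ratio_upper Z 2 (by norm_num : (0 : ℝ) ≤ 1045)
      (fun n hn => (Z_ratio_bounds n hn).2.2) m
    rwa [Z_two] at h
  have hZ0 : 0 ≤ Z (2 + m) := (Z_ratio_bounds (2 + m) hn).1.le
  -- denominators: `|q (2+m)| ≥ 17934 · 796^m`, `|q (2+m+1)| ≥ 17934 · 796^(m+1)`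
  have hq0 : 17934 * (796 : ℝ) ^ m ≤ |(q (2 + m) : ℝ)| := le_abs_q m
  have hq1 : 17934 * (796 : ℝ) ^ (m + 1) ≤ |(q (2 + m + 1) : ℝ)| := by
    have h := le_abs_q (m + 1)
    rwa [show 2 + (m + 1) = 2 + m + 1 by ring] at h
  have hpos0 : (0 : ℝ) < 17934 * 796 ^ m := by positivity
  have hpos1 : (0 : ℝ) < 17934 * 796 ^ (m + 1) := by positivity
  have hden : 17934 * (796 : ℝ) ^ m * (17934 * 796 ^ (m + 1)) ≤
      |(q (2 + m) : ℝ)| * |(q (2 + m + 1) : ℝ)| :=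
    mul_le_mul hq0 hq1 hpos1.le (abs_nonneg _)
  have hdenpos : (0 : ℝ) < |(q (2 + m) : ℝ)| * |(q (2 + m + 1) : ℝ)| :=
    (mul_pos hpos0 hpos1).trans_le hden
  calc Z (2 + m) / (|(q (2 + m) : ℝ)| * |(q (2 + m + 1) : ℝ)|)
      ≤ (5038915 / 108 * 1045 ^ m) / (17934 * (796 : ℝ) ^ m * (17934 * 796 ^ (m + 1))) := by
        gcongr
    _ = 5038915 / 108 / (17934 ^ 2 * 796) * (1045 / 796 ^ 2) ^ m := by
        rw [div_pow, ← pow_mul, pow_succ]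
        field_simp
        ring

/-- **The approximants converge geometrically**: there is a real number `L` with `pₙ/qₙ → L`
and `|p_{2+m}/q_{2+m} - L| ≤ K θ^m/(1 - θ)` for every `m` (`K, θ` as in `abs_ratio_step_le`). -/
theorem exists_limit :
    ∃ L : ℝ, Tendsto (fun n : ℕ => (p n : ℝ) / q n) atTop (𝓝 L) ∧
      ∀ m : ℕ, |(p (2 + m) : ℝ) / q (2 + m) - L| ≤
        5038915 / 108 / (17934 ^ 2 * 796) * (1045 / 796 ^ 2) ^ m / (1 - 1045 / 796 ^ 2) := by
  set f : ℕ → ℝ := fun m => (p (2 + m) : ℝ) / q (2 + m) with hf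
  have hθ : (1045 / 796 ^ 2 : ℝ) < 1 := by norm_num
  have hstep : ∀ m, dist (f m) (f (m + 1)) ≤
      5038915 / 108 / (17934 ^ 2 * 796) * (1045 / 796 ^ 2 : ℝ) ^ m := by
    intro m
    rw [dist_comm, Real.dist_eq, hf]
    simp only
    rw [show 2 + (m + 1) = 2 + m + 1 by ring]
    exact abs_ratio_step_le m
  have hcauchy := cauchySeq_of_le_geometric _ _ hθ hstep
  obtain ⟨L, hL⟩ := cauchySeq_tendsto_of_complete hcauchy
  refine ⟨L, ?_, fun m => ?_⟩
  · -- `pₙ/qₙ → L` along all `n` (shift by `2`)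
    have h2 : Tendsto (fun m : ℕ => (p (m + 2) : ℝ) / q (m + 2)) atTop (𝓝 L) :=
      hL.congr fun m => by simp only [hf, add_comm]
    exact (tendsto_add_atTop_iff_nat 2).1 h2
  · have h := dist_le_of_le_geometric_of_tendsto _ _ hθ hstep hL m
    rwa [Real.dist_eq] at h

/-- **Conditional approximation rate for `ζ(5)`.** IF `pₙ/qₙ → ζ(5)` (Zudilin's Theorem 1: the
linear forms `ℓₙ = qₙζ(5) - pₙ` tend to `0`; NOT proved here), then for every `m`:
`|ζ(5) - p_{2+m}/q_{2+m}| ≤ K θ^m/(1 - θ)` with the certified constants of `exists_limit`. -/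
theorem abs_sub_zetaFive_le_of_tendsto
    (h : Tendsto (fun n : ℕ => (p n : ℝ) / q n) atTop (𝓝 (zetaValue 5))) (m : ℕ) :
    |zetaValue 5 - (p (2 + m) : ℝ) / q (2 + m)| ≤
      5038915 / 108 / (17934 ^ 2 * 796) * (1045 / 796 ^ 2) ^ m / (1 - 1045 / 796 ^ 2) := by
  obtain ⟨L, hL, hbound⟩ := exists_limit
  have hLζ : L = zetaValue 5 := tendsto_nhds_unique hL h
  rw [← hLζ, abs_sub_comm]
  exact hbound m

/-! ### The identification of the limit, from Zudilin's Theorem 1 (conditional) -/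

/-- **Zudilin's Theorem 1 identifies the limit** (CONDITIONAL on the tree's named fact
`theorem1_rates`, eqs. (4)–(5) of the paper, not proved in the tree): `log|ℓₙ|/n → log μ₂ < 0`
forces `ℓₙ = qₙζ(5) - pₙ → 0`, hence `pₙ/qₙ → ζ(5)` since `|qₙ| ≥ 17934` for `n ≥ 2`. -/
theorem tendsto_ratio_of_theorem1_rates (h : theorem1_rates) :
    Tendsto (fun n : ℕ => (p n : ℝ) / q n) atTop (𝓝 (zetaValue 5)) := by
  obtain ⟨μ₂, μ₃, -, hμ₂, -, -, hell, -⟩ := h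
  have hμ₂0 : 0 < μ₂ := lt_trans (by norm_num) hμ₂.1
  have hμ₂1 : μ₂ < 1 := lt_trans hμ₂.2 (by norm_num)
  have hlog : Real.log μ₂ < 0 := Real.log_neg hμ₂0 hμ₂1
  set c : ℝ := Real.log μ₂ / 2 with hc
  have hc0 : c < 0 := by rw [hc]; linarith
  -- eventually `|ℓ n| ≤ exp (c n)`
  have hsmall : ∀ᶠ n : ℕ in atTop, |ell n| ≤ Real.exp (c * n) := by
    filter_upwards [hell.eventually (gt_mem_nhds (show Real.log μ₂ < c by rw [hc]; linarith)),
      eventually_ge_atTop 1] with n hn hn1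
    have hn0 : (0 : ℝ) < n := by exact_mod_cast hn1
    rw [div_lt_iff₀ hn0] at hn
    by_cases h0 : ell n = 0
    · rw [h0, abs_zero]; exact (Real.exp_pos _).le
    · have hpos : 0 < |ell n| := abs_pos.2 h0
      exact ((Real.log_lt_iff_lt_exp hpos).1 hn).le
  have hlim0 : Tendsto (fun n : ℕ => |ell n|) atTop (𝓝 0) := by
    have hexp : Tendsto (fun n : ℕ => Real.exp (c * n)) atTop (𝓝 0) := by
      refine Real.tendsto_exp_atBot.comp ?_
      have h1 : Tendsto (fun n : ℕ => -c * (n : ℝ)) atTop atTop :=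
        (tendsto_natCast_atTop_atTop).const_mul_atTop (by linarith)
      exact (tendsto_neg_atTop_atBot.comp h1).congr fun n => by simp
    exact squeeze_zero' (Eventually.of_forall fun n => abs_nonneg _) hsmall hexp
  -- `|p n / q n - ζ(5)| = |ℓ n| / |q n| ≤ |ℓ n|` for `n ≥ 2`
  rw [← tendsto_sub_nhds_zero_iff]
  refine squeeze_zero_norm' ?_ hlim0
  filter_upwards [eventually_ge_atTop 2] with n hn
  obtain ⟨m, rfl⟩ : ∃ m, n = 2 + m := ⟨n - 2, by omega⟩
  have hq : (17934 : ℝ) * 796 ^ m ≤ |(q (2 + m) : ℝ)| := le_abs_q m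
  have hq1 : (1 : ℝ) ≤ |(q (2 + m) : ℝ)| :=
    le_trans (by nlinarith [one_le_pow₀ (by norm_num : (1 : ℝ) ≤ 796) (n := m)]) hq
  have hq0 : (q (2 + m) : ℝ) ≠ 0 := by
    intro h0; rw [h0, abs_zero] at hq1; linarith
  have e : (p (2 + m) : ℝ) / q (2 + m) - zetaValue 5 = -(ell (2 + m)) / q (2 + m) := by
    unfold ell; field_simp; ring
  rw [Real.norm_eq_abs, e, abs_div, abs_neg]
  exact div_le_self (abs_nonneg _) hq1

/-- **Certified approximation rate, conditional on Zudilin's Theorem 1**: for every `m`,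
`|ζ(5) - p_{2+m}/q_{2+m}| ≤ K θ^m/(1 - θ)` with `K = (5038915/108)/(17934²·796)`,
`θ = 1045/796²`. -/
theorem abs_sub_zetaFive_le_of_theorem1_rates (h : theorem1_rates) (m : ℕ) :
    |zetaValue 5 - (p (2 + m) : ℝ) / q (2 + m)| ≤
      5038915 / 108 / (17934 ^ 2 * 796) * (1045 / 796 ^ 2) ^ m / (1 - 1045 / 796 ^ 2) :=
  abs_sub_zetaFive_le_of_tendsto (tendsto_ratio_of_theorem1_rates h) m

end Zudilin2002Growth

end Summit.KontsevichZagierPeriods.Zeta5Search
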